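import Literature.Probability.FitznerVanDerHofstad2017.SrwTrigMajorant
import Literature.Probability.FitznerVanDerHofstad2017.SrwChatPowSchwinger
import Literature.Analysis.FunctionSpaces.BesselJAnalyticProofs
import Mathlib.MeasureTheory.Integral.IntervalIntegral.Periodic
import Mathlib.RingTheory.RootsOfUnity.Complex
import HarnessLib

/-!
# The twisted one-coordinate transform as a Bessel row: `B_m(v,y) = 2π Σ_{j ∈ ℤ} i^{|j|} J_{|j|}(y) I_{jm}(v)`

Reproduction-side kernel lemma for the simple-random-walk integrals of
Fitzner–van der Hofstad [FitznerVanDerHofstad2016NoBLE, (3.34)–(3.36) p. 1071; §5.1.1 (5.2)–(5.4)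
pp. 1089–1090] at an AXIS node `x = m e_i`.  After the Schwinger parametrisation `Ĉ^{n+1} =
(n!)⁻¹∫₀^∞ τⁿ e^{-(1-D̂)τ} dτ` and the factorisation of the cube integral over coordinates
(`SrwChatPowSchwinger.lean`), every TWISTED moment
`∫ cos(β D̂^{(m e_i)}(k)) Ĉ(k)^{n+1} dk/(2π)^d` (the seeds `srwTwist` of the separable trigonometric
majorant, `SrwTrigMajorant.lean`) is a one-dimensional `τ`-integral of `Re B_m(τ/d, β/d)^d`, where

  `B_m(v, y) = ∫_{-π}^{π} e^{v cos t + i y cos(m t)} dt`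

is the twisted one-coordinate transform.  This file proves, for every integer `m ≠ 0`:

* `integral_cexp_int_mul_mul_cexp_cos_int_mul_μI` — the FOURIER COEFFICIENTS of the twist
  `e^{i y cos(m t)}` on `[-π, π]`:  `∫ e^{iat} e^{iy cos(mt)} dt = 2π i^{|a/m|} J_{|a/m|}(y)` if
  `m ∣ a` and `0` otherwise (`a ∈ ℤ`) — Bessel's integral [DLMF, 10.9.2] moved from `sin` to `cos`
  by a quarter-period shift (the Jacobi–Anger coefficients [DLMF, 10.12.2–10.12.3]), a full-period
  dilation `t ↦ m t`, and ONE shift `t ↦ t + 2π/|m|` (which multiplies the integrand by a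
  non-trivial `|m|`-th root of unity when `m ∤ a`);
* `hasSum_besselRow_μI` — the BESSEL ROW: termwise integration of the tree's generating function
  `e^{v cos t} = Σ_{a ∈ ℤ} I_a(v) e^{iat}` (`Literature.Probability.LatticeModels.hasSum_besselI_mul_zpow`,
  [DLMF, 10.35.1–10.35.2]) against the bounded twist gives the absolutely convergent expansion
  `B_m(v,y) = Σ_{j ∈ ℤ} I_{jm}(v) · 2π i^{|j|} J_{|j|}(y)` as a `HasSum` over `j : ℤ`
  (`integral_cexp_cos_add_cos_int_mul_μI_eq_tsum`: the `tsum` form; `summable_norm_besselRow`: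
  absolute convergence; `hasSum_besselRow_nat_μI`: the folded one-sided form
  `B_m = 2π (I_0 J_0 + 2 Σ_{j ≥ 1} iʲ J_j(y) I_{jm}(v))` over `j : ℕ`, using `I_{-a} = I_a`);
* `srwTwist_succ_one_single_eq_integral_axisTransform` — the GLUE to the consumer interface of the
  trigonometric-majorant reduction (weight `w = 1`): for `d ≥ 2n + 3` and every `m : ℤ`,
  `srwTwist d (n+1) 1 (m e_i) β = (n!)⁻¹ (∫₀^∞ τⁿ e^{-τ} Re B_m(τ/d, β/d)^d dτ) / (2π)^d`
  (`srwTwist_succ_one_single_eq_integral_besselRow`: the same with `B_m` replaced by its row, `m ≠ 0`).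

Everything is PROVED (standard axioms); no definition, no named fact, no numeral table; `d`-free
resp. `d`-generic.  Epistemic status / lane: what-if / input-certification SUPPORT — these are the
semantics that a kernel certificate of the twisted seeds (rows `(Σ_a c(a) I_a(v))^d` with
`c(jm) = ε_j iʲ J_j(y)`) has to be proved sound against; nothing here is a certificate and no
statement at a specific dimension is made.

## References

* R. Fitzner, R. van der Hofstad, *Generalized approach to the non-backtracking lace expansion*,
  PTRF 169 (2017) 1041–1119, (3.34)–(3.36) p. 1071, §5.1.1 (5.2)–(5.4). [FitznerVanDerHofstad2016NoBLE]
* NIST DLMF §10.9.2 (Bessel's integral `J_n(z) = (i^{-n}/π)∫₀^π e^{iz cos θ} cos(nθ) dθ`),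
  §10.12.1–10.12.3 (Jacobi–Anger expansions), §10.35.1–10.35.2 (generating function of `I_n`). [DLMF]
* G. N. Watson, *A Treatise on the Theory of Bessel Functions*, 2nd ed. (CUP 1944), §2.1–§2.22. [Watson1944]
-/

noncomputable section

open MeasureTheory Set Filter Real
open scoped Topology Nat

namespace Literature.Probability.FitznerVanDerHofstad2017

open Literature.Barriers.CriticalPhenomena
open Literature.Barriers.CriticalPhenomena.Slade2006Prop53 (μI P)
open Literature.Probability.LatticeModels (besselI hasSum_besselI_mul_zpow summable_abs_besselI)
open Literature.Analysis.FunctionSpaces (besselJ integral_cexp_mul_sin_sub)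

/-! ### 1. Full-period bookkeeping on `[0, 2π]` and `[-π, π]` -/
section FullPeriod

/-- For a `2π`-periodic `g`, `∫ g dμI = ∫₀^{2π} g` (plumbing). [folklore] -/
private theorem integral_μI_eq_intervalIntegral_of_periodic {g : ℝ → ℂ}
    (hper : Function.Periodic g (2 * π)) :
    ∫ t, g t ∂μI = ∫ t in (0:ℝ)..2 * π, g t := by
  rw [show μI = volume.restrict (Icc (-π) π) from rfl, integral_Icc_eq_integral_Ioc,
    ← intervalIntegral.integral_of_le (by linarith [Real.pi_pos] : -π ≤ π)]
  have h := hper.intervalIntegral_add_eq (-π) 0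
  rw [show -π + 2 * π = π by ring, zero_add] at h
  exact h

/-- Shift invariance of a full-period integral: `∫₀^{2π} f(t + c) dt = ∫₀^{2π} f(t) dt` for
`2π`-periodic `f` (plumbing). [folklore] -/
private theorem intervalIntegral_comp_add_right_of_periodic {f : ℝ → ℂ}
    (hper : Function.Periodic f (2 * π)) (c : ℝ) :
    ∫ t in (0:ℝ)..2 * π, f (t + c) = ∫ t in (0:ℝ)..2 * π, f t := by
  rw [intervalIntegral.integral_comp_add_right f c, zero_add]
  have h := hper.intervalIntegral_add_eq c 0
  rw [zero_add] at h
  rw [show 2 * π + c = c + 2 * π by ring, h]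

/-- Full-period dilation: `∫₀^{2π} g(n t) dt = ∫₀^{2π} g(t) dt` for continuous `2π`-periodic `g`
and `0 < n` (plumbing). [folklore] -/
private theorem intervalIntegral_comp_natCast_mul_of_periodic {g : ℝ → ℂ} (hg : Continuous g)
    (hper : Function.Periodic g (2 * π)) {n : ℕ} (hn : 0 < n) :
    ∫ t in (0:ℝ)..2 * π, g (n * t) = ∫ t in (0:ℝ)..2 * π, g t := by
  have hn' : (n : ℝ) ≠ 0 := by exact_mod_cast hn.ne'
  rw [intervalIntegral.integral_comp_mul_left g hn', mul_zero]
  have h := hper.intervalIntegral_add_zsmul_eq (n : ℤ) 0 (fun t₁ t₂ => hg.intervalIntegrable t₁ t₂)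
  have hend : (0:ℝ) + (n : ℤ) • (2 * π) = n * (2 * π) := by
    rw [zsmul_eq_mul, Int.cast_natCast]; ring
  rw [hend, zero_add] at h
  rw [h, ← Int.cast_smul_eq_zsmul ℝ, Int.cast_natCast, smul_smul, inv_mul_cancel₀ hn', one_smul]

/-- `e^{iπ/2} = i`. [folklore] -/
private theorem cexp_pi_div_two_mul_I : Complex.exp (((π / 2 : ℝ) : ℂ) * Complex.I) = Complex.I := by
  rw [Complex.exp_mul_I]
  push_cast
  rw [Complex.cos_pi_div_two, Complex.sin_pi_div_two, one_mul, zero_add]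

/-- `|e^{iat}| = 1` for an integer frequency `a`. [folklore] -/
private theorem norm_cexp_intCast_mul (a : ℤ) (t : ℝ) :
    ‖Complex.exp ((a : ℂ) * t * Complex.I)‖ = 1 := by
  rw [show (a : ℂ) * t * Complex.I = (((a : ℝ) * t : ℝ) : ℂ) * Complex.I by push_cast; ring]
  exact Complex.norm_exp_ofReal_mul_I _

/-- The character `t ↦ e^{iat}` (`a ∈ ℤ`) is `2π`-periodic. [folklore] -/
private theorem cexp_intCast_mul_add_two_pi (a : ℤ) (t : ℝ) :
    Complex.exp ((a : ℂ) * ((t + 2 * π : ℝ) : ℂ) * Complex.I) = Complex.exp ((a : ℂ) * t * Complex.I) := by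
  rw [show (a : ℂ) * ((t + 2 * π : ℝ) : ℂ) * Complex.I
      = (a : ℂ) * t * Complex.I + (a : ℂ) * (2 * π * Complex.I) by push_cast; ring,
    Complex.exp_add, Complex.exp_int_mul_two_pi_mul_I, mul_one]

end FullPeriod

/-! ### 2. The Fourier coefficients of the twist `e^{iy cos(m t)}` -/
section Coefficients

/-- **Bessel's integral in cosine form**: `∫₀^{2π} e^{iy cos θ} e^{-inθ} dθ = 2π iⁿ J_n(y)`
(`n ∈ ℕ`; quarter-period shift of `∫₀^{2π} e^{iy sin θ} e^{-inθ} dθ = 2π J_n(y)`).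
[cite: DLMF, 10.9.2] -/
theorem integral_cexp_cos_mul_cexp_neg_nat (n : ℕ) (y : ℝ) :
    ∫ θ in (0:ℝ)..2 * π, Complex.exp ((y : ℂ) * (Real.cos θ : ℝ) * Complex.I)
        * Complex.exp (-((n : ℂ) * θ * Complex.I))
      = 2 * π * Complex.I ^ n * (besselJ n y : ℂ) := by
  set f : ℝ → ℂ := fun θ => Complex.exp ((y : ℂ) * (Real.cos θ : ℝ) * Complex.I)
    * Complex.exp (-((n : ℂ) * θ * Complex.I)) with hf
  have hper : Function.Periodic f (2 * π) := by
    intro θ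
    simp only [hf, Real.cos_add_two_pi]
    congr 1
    rw [show -((n : ℂ) * ((θ + 2 * π : ℝ) : ℂ) * Complex.I)
        = -((n : ℂ) * θ * Complex.I) + ((-(n : ℤ) : ℤ) : ℂ) * (2 * π * Complex.I) by push_cast; ring,
      Complex.exp_add, Complex.exp_int_mul_two_pi_mul_I, mul_one]
  have hshift : ∀ θ : ℝ, f (θ + -(π / 2))
      = Complex.exp ((y : ℂ) * (Real.sin θ : ℝ) * Complex.I) * Complex.exp (-((n : ℂ) * θ * Complex.I))
          * Complex.I ^ n := by
    intro θ
    simp only [hf]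
    rw [show θ + -(π / 2) = θ - π / 2 by ring, Real.cos_sub_pi_div_two,
      show -((n : ℂ) * ((θ - π / 2 : ℝ) : ℂ) * Complex.I)
        = -((n : ℂ) * θ * Complex.I) + (n : ℂ) * (((π / 2 : ℝ) : ℂ) * Complex.I) by push_cast; ring,
      Complex.exp_add, Complex.exp_nat_mul, cexp_pi_div_two_mul_I]
    ring
  change ∫ θ in (0:ℝ)..2 * π, f θ = _
  rw [← intervalIntegral_comp_add_right_of_periodic hper (-(π / 2))]
  simp_rw [hshift]
  rw [intervalIntegral.integral_mul_const, integral_cexp_mul_sin_sub n y]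
  ring

/-- The same with the conjugate character: `∫₀^{2π} e^{iy cos θ} e^{+inθ} dθ = 2π iⁿ J_n(y)`
(`cos` is even: substitute `θ ↦ -θ`). [cite: DLMF, 10.9.2] -/
theorem integral_cexp_cos_mul_cexp_nat (n : ℕ) (y : ℝ) :
    ∫ θ in (0:ℝ)..2 * π, Complex.exp ((y : ℂ) * (Real.cos θ : ℝ) * Complex.I)
        * Complex.exp ((n : ℂ) * θ * Complex.I)
      = 2 * π * Complex.I ^ n * (besselJ n y : ℂ) := by
  set f : ℝ → ℂ := fun θ => Complex.exp ((y : ℂ) * (Real.cos θ : ℝ) * Complex.I)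
    * Complex.exp (-((n : ℂ) * θ * Complex.I)) with hf
  have hper : Function.Periodic f (2 * π) := by
    intro θ
    simp only [hf, Real.cos_add_two_pi]
    congr 1
    rw [show -((n : ℂ) * ((θ + 2 * π : ℝ) : ℂ) * Complex.I)
        = -((n : ℂ) * θ * Complex.I) + ((-(n : ℤ) : ℤ) : ℂ) * (2 * π * Complex.I) by push_cast; ring,
      Complex.exp_add, Complex.exp_int_mul_two_pi_mul_I, mul_one]
  have hneg : ∀ θ : ℝ, Complex.exp ((y : ℂ) * (Real.cos θ : ℝ) * Complex.I)
      * Complex.exp ((n : ℂ) * θ * Complex.I) = f (-θ) := by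
    intro θ
    simp only [hf, Real.cos_neg]
    congr 2
    push_cast
    ring
  simp_rw [hneg]
  rw [intervalIntegral.integral_comp_neg, neg_zero]
  have h := hper.intervalIntegral_add_eq (-(2 * π)) 0
  rw [neg_add_cancel, zero_add] at h
  rw [h]
  exact integral_cexp_cos_mul_cexp_neg_nat n y

/-- Integer frequencies: `∫₀^{2π} e^{iat} e^{iy cos θ} dθ = 2π i^{|a|} J_{|a|}(y)` for every `a ∈ ℤ`.
[cite: DLMF, 10.12.2] -/
theorem integral_cexp_int_mul_mul_cexp_cos (a : ℤ) (y : ℝ) :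
    ∫ θ in (0:ℝ)..2 * π, Complex.exp ((a : ℂ) * θ * Complex.I)
        * Complex.exp (((y * Real.cos θ : ℝ) : ℂ) * Complex.I)
      = 2 * π * Complex.I ^ a.natAbs * (besselJ a.natAbs y : ℂ) := by
  have hcast : ∀ θ : ℝ, Complex.exp (((y * Real.cos θ : ℝ) : ℂ) * Complex.I)
      = Complex.exp ((y : ℂ) * (Real.cos θ : ℝ) * Complex.I) := by
    intro θ; push_cast; rfl
  simp_rw [hcast, mul_comm (Complex.exp ((a : ℂ) * _ * Complex.I)) _]
  rcases Int.natAbs_eq a with h | h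
  · conv_lhs => rw [h]
    simp only [Int.cast_natCast]
    exact integral_cexp_cos_mul_cexp_nat a.natAbs y
  · conv_lhs => rw [h]
    simp only [Int.cast_neg, Int.cast_natCast, neg_mul]
    exact integral_cexp_cos_mul_cexp_neg_nat a.natAbs y

/-- Dilated, divisible case: `∫₀^{2π} e^{i(jn)t} e^{iy cos(nt)} dt = 2π i^{|j|} J_{|j|}(y)` for
`0 < n` (full-period dilation `t ↦ n t`). [cite: DLMF, 10.12.2] -/
theorem integral_cexp_int_mul_natCast_mul_mul_cexp_cos_natCast_mul (j : ℤ) {n : ℕ} (hn : 0 < n)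
    (y : ℝ) :
    ∫ t in (0:ℝ)..2 * π, Complex.exp (((j * n : ℤ) : ℂ) * t * Complex.I)
        * Complex.exp (((y * Real.cos (n * t) : ℝ) : ℂ) * Complex.I)
      = 2 * π * Complex.I ^ j.natAbs * (besselJ j.natAbs y : ℂ) := by
  set G : ℝ → ℂ := fun s => Complex.exp ((j : ℂ) * s * Complex.I)
    * Complex.exp (((y * Real.cos s : ℝ) : ℂ) * Complex.I) with hG
  have hGc : Continuous G := by simp only [hG]; fun_prop
  have hGper : Function.Periodic G (2 * π) := by
    intro s
    simp only [hG, Real.cos_add_two_pi, cexp_intCast_mul_add_two_pi]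
  have hcomp : ∀ t : ℝ, Complex.exp (((j * n : ℤ) : ℂ) * t * Complex.I)
      * Complex.exp (((y * Real.cos (n * t) : ℝ) : ℂ) * Complex.I) = G (n * t) := by
    intro t
    simp only [hG]
    congr 2
    push_cast
    ring
  simp_rw [hcomp]
  rw [intervalIntegral_comp_natCast_mul_of_periodic hGc hGper hn]
  exact integral_cexp_int_mul_mul_cexp_cos j y

/-- Dilated, non-divisible case: `∫₀^{2π} e^{iat} e^{iy cos(nt)} dt = 0` when `0 < n` and `n ∤ a`:
the shift `t ↦ t + 2π/n` leaves `cos(nt)` invariant and multiplies `e^{iat}` by the root of unity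
`e^{2πia/n} ≠ 1`. [cite: DLMF, 10.12.2] -/
theorem integral_cexp_int_mul_mul_cexp_cos_natCast_mul_eq_zero {a : ℤ} {n : ℕ} (hn : 0 < n)
    (hna : ¬ (n : ℤ) ∣ a) (y : ℝ) :
    ∫ t in (0:ℝ)..2 * π, Complex.exp ((a : ℂ) * t * Complex.I)
        * Complex.exp (((y * Real.cos (n * t) : ℝ) : ℂ) * Complex.I) = 0 := by
  set F : ℝ → ℂ := fun t => Complex.exp ((a : ℂ) * t * Complex.I)
    * Complex.exp (((y * Real.cos (n * t) : ℝ) : ℂ) * Complex.I) with hF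
  have hn0 : (n : ℝ) ≠ 0 := by exact_mod_cast hn.ne'
  have hFper : Function.Periodic F (2 * π) := by
    intro t
    simp only [hF, cexp_intCast_mul_add_two_pi]
    rw [show (n : ℝ) * (t + 2 * π) = n * t + (n : ℤ) * (2 * π) by push_cast; ring,
      Real.cos_add_int_mul_two_pi]
  -- the root of unity picked up by the shift `t ↦ t + 2π/n`
  set ω : ℂ := Complex.exp ((a : ℂ) * (2 * π * Complex.I / n)) with hω
  have hshift : ∀ t : ℝ, F (t + 2 * π / n) = ω * F t := by
    intro t
    simp only [hF, hω]
    rw [show (n : ℝ) * (t + 2 * π / n) = n * t + (1 : ℤ) * (2 * π) by field_simp; push_cast; ring,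
      Real.cos_add_int_mul_two_pi,
      show (a : ℂ) * ((t + 2 * π / n : ℝ) : ℂ) * Complex.I
        = (a : ℂ) * (2 * π * Complex.I / n) + (a : ℂ) * t * Complex.I by push_cast; ring,
      Complex.exp_add]
    ring
  have hω1 : ω ≠ 1 := by
    intro h1
    have hprim : IsPrimitiveRoot (Complex.exp (2 * π * Complex.I / n)) n :=
      Complex.isPrimitiveRoot_exp n hn.ne'
    have hpow : Complex.exp (2 * π * Complex.I / n) ^ a = 1 := by
      rw [← Complex.exp_int_mul]; exact h1
    exact hna ((hprim.zpow_eq_one_iff_dvd a).1 hpow)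
  have key : ω * (∫ t in (0:ℝ)..2 * π, F t) = ∫ t in (0:ℝ)..2 * π, F t := by
    rw [← intervalIntegral.integral_const_mul]
    simp_rw [← hshift]
    exact intervalIntegral_comp_add_right_of_periodic hFper (2 * π / n)
  have key' : (ω - 1) * (∫ t in (0:ℝ)..2 * π, F t) = 0 := by rw [sub_mul, one_mul, key, sub_self]
  exact (mul_eq_zero.1 key').resolve_left (sub_ne_zero.2 hω1)

/-- **The Fourier coefficients of the twist on `[-π, π]`**: for every integer `m ≠ 0` and `a ∈ ℤ`,
`∫ e^{iat} e^{iy cos(mt)} dμI = 2π i^{|a/m|} J_{|a/m|}(y)` if `m ∣ a`, and `0` otherwise.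
[cite: DLMF, 10.12.2] -/
theorem integral_cexp_int_mul_mul_cexp_cos_int_mul_μI (y : ℝ) {m : ℤ} (hm : m ≠ 0) (a : ℤ) :
    ∫ t, Complex.exp ((a : ℂ) * t * Complex.I)
        * Complex.exp (((y * Real.cos (m * t) : ℝ) : ℂ) * Complex.I) ∂μI
      = if m ∣ a then 2 * π * Complex.I ^ (a / m).natAbs * (besselJ (a / m).natAbs y : ℂ) else 0 := by
  -- pass to `[0, 2π]`
  have hper : Function.Periodic (fun t : ℝ => Complex.exp ((a : ℂ) * t * Complex.I)
      * Complex.exp (((y * Real.cos (m * t) : ℝ) : ℂ) * Complex.I)) (2 * π) := by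
    intro t
    simp only [cexp_intCast_mul_add_two_pi]
    rw [show (m : ℝ) * (t + 2 * π) = m * t + m * (2 * π) by ring, Real.cos_add_int_mul_two_pi]
  rw [integral_μI_eq_intervalIntegral_of_periodic hper]
  -- reduce `m` to `n = |m| > 0`
  set n : ℕ := m.natAbs with hn
  have hn0 : 0 < n := Int.natAbs_pos.2 hm
  have hcos : ∀ t : ℝ, Real.cos (m * t) = Real.cos (n * t) := by
    intro t
    rcases Int.natAbs_eq m with h | h
    · conv_lhs => rw [h]
      simp [hn]
    · conv_lhs => rw [h]
      simp [hn, Real.cos_neg, neg_mul]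
  simp_rw [hcos]
  split_ifs with hdiv
  · -- `a = (a/m) m = j n` with `j = ± (a/m)`
    rcases Int.natAbs_eq m with h | h
    · have ha : a = (a / m * n : ℤ) := by
        rw [hn, ← h]; exact (Int.ediv_mul_cancel hdiv).symm
      conv_lhs => rw [ha]
      rw [integral_cexp_int_mul_natCast_mul_mul_cexp_cos_natCast_mul (a / m) hn0 y]
    · have ha : a = (-(a / m) * n : ℤ) := by
        rw [hn, neg_mul, ← mul_neg, ← h]; exact (Int.ediv_mul_cancel hdiv).symm
      conv_lhs => rw [ha]
      rw [integral_cexp_int_mul_natCast_mul_mul_cexp_cos_natCast_mul (-(a / m)) hn0 y, Int.natAbs_neg]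
  · have hna : ¬ (n : ℤ) ∣ a := by rwa [hn, Int.natAbs_dvd]
    exact integral_cexp_int_mul_mul_cexp_cos_natCast_mul_eq_zero hn0 hna y

end Coefficients

/-! ### 3. The Bessel row -/
section Row

/-- **The twisted one-coordinate transform as a Bessel row.** For `v y : ℝ` and an integer `m ≠ 0`,
`B_m(v,y) = ∫_{[-π,π]} e^{v cos t + iy cos(mt)} dt = Σ_{j ∈ ℤ} I_{jm}(v) · 2π i^{|j|} J_{|j|}(y)`,
the series converging absolutely (`Σ_a |I_a(v)| = e^{|v|}`): termwise integration (dominated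
convergence) of the generating function `e^{v cos t} = Σ_{a ∈ ℤ} I_a(v) e^{iat}` against the twist,
whose Fourier coefficients vanish off the multiples of `m`.
[cite: DLMF, 10.35.2; DLMF, 10.12.2; FitznerVanDerHofstad2016NoBLE, §5.1.1 (5.2)–(5.4)] -/
theorem hasSum_besselRow_μI (v y : ℝ) {m : ℤ} (hm : m ≠ 0) :
    HasSum (fun j : ℤ => (besselI (j * m) v : ℂ)
        * (2 * π * Complex.I ^ j.natAbs * (besselJ j.natAbs y : ℂ)))
      (∫ t, Complex.exp (((v * Real.cos t : ℝ) : ℂ) + ((y * Real.cos (m * t) : ℝ) : ℂ) * Complex.I) ∂μI) := by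
  set E : ℝ → ℂ := fun t => Complex.exp (((y * Real.cos (m * t) : ℝ) : ℂ) * Complex.I) with hE
  have hEc : Continuous E := by simp only [hE]; fun_prop
  have hEn : ∀ t, ‖E t‖ = 1 := fun t => by simp only [hE]; exact Complex.norm_exp_ofReal_mul_I _
  set F : ℤ → ℝ → ℂ := fun a t => (besselI a v : ℂ) * (Complex.exp ((a : ℂ) * t * Complex.I) * E t)
    with hF
  -- the generating function, pointwise, times the twist
  have hgen : ∀ t : ℝ, HasSum (fun a : ℤ => F a t)
      (Complex.exp (((v * Real.cos t : ℝ) : ℂ) + ((y * Real.cos (m * t) : ℝ) : ℂ) * Complex.I)) := by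
    intro t
    have h := (hasSum_besselI_mul_zpow v (Circle.exp t)).mul_right (E t)
    have hz : ((Circle.exp t : Circle) : ℂ) = Complex.exp (t * Complex.I) := Circle.coe_exp t
    have hterm : (fun a : ℤ => (besselI a v : ℂ) * ((Circle.exp t : Circle) : ℂ) ^ a * E t) = fun a => F a t := by
      funext a
      simp only [hF, hz, ← Complex.exp_int_mul]
      rw [mul_assoc, show (a : ℂ) * (t * Complex.I) = (a : ℂ) * t * Complex.I by ring]
    have hval : ((Real.exp (v * ((Circle.exp t : Circle) : ℂ).re) : ℝ) : ℂ) * E t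
        = Complex.exp (((v * Real.cos t : ℝ) : ℂ) + ((y * Real.cos (m * t) : ℝ) : ℂ) * Complex.I) := by
      rw [hz, Complex.exp_ofReal_mul_I_re, Complex.ofReal_exp, hE, ← Complex.exp_add]
    rw [hterm, hval] at h
    exact h
  -- dominated convergence for the series (bound `|I_a(v)|`, summable, constant in `t`)
  have hsum : HasSum (fun a : ℤ => ∫ t, F a t ∂μI)
      (∫ t, Complex.exp (((v * Real.cos t : ℝ) : ℂ) + ((y * Real.cos (m * t) : ℝ) : ℂ) * Complex.I) ∂μI) := by
    refine hasSum_integral_of_dominated_convergence (fun a _ => |besselI a v|) (fun a => ?_)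
      (fun a => ae_of_all _ fun t => ?_) (ae_of_all _ fun _ => summable_abs_besselI v)
      (integrable_const _) (ae_of_all _ fun t => hgen t)
    · exact Continuous.aestronglyMeasurable (by simp only [hF]; fun_prop)
    · simp only [hF]
      rw [norm_mul, norm_mul, hEn, norm_cexp_intCast_mul, mul_one, mul_one, Complex.norm_real,
        Real.norm_eq_abs]
  -- evaluate each term by the Fourier coefficients of the twist
  have hterm : ∀ a : ℤ, ∫ t, F a t ∂μI = (besselI a v : ℂ)
      * (if m ∣ a then 2 * π * Complex.I ^ (a / m).natAbs * (besselJ (a / m).natAbs y : ℂ) else 0) := by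
    intro a
    simp only [hF]
    rw [integral_const_mul, integral_cexp_int_mul_mul_cexp_cos_int_mul_μI y hm a]
  simp_rw [hterm] at hsum
  -- reindex along `a = j m`
  have hinj : Function.Injective (fun j : ℤ => j * m) := mul_left_injective₀ hm
  have hzero : ∀ a ∉ Set.range (fun j : ℤ => j * m), (besselI a v : ℂ)
      * (if m ∣ a then 2 * π * Complex.I ^ (a / m).natAbs * (besselJ (a / m).natAbs y : ℂ) else 0) = 0 := by
    intro a ha
    have hna : ¬ m ∣ a := fun ⟨c, hc⟩ => ha ⟨c, by rw [hc, mul_comm]⟩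
    rw [if_neg hna, mul_zero]
  have h := (hinj.hasSum_iff hzero).2 hsum
  have hfun : ((fun a : ℤ => (besselI a v : ℂ)
      * (if m ∣ a then 2 * π * Complex.I ^ (a / m).natAbs * (besselJ (a / m).natAbs y : ℂ) else 0))
        ∘ fun j : ℤ => j * m)
      = fun j : ℤ => (besselI (j * m) v : ℂ) * (2 * π * Complex.I ^ j.natAbs * (besselJ j.natAbs y : ℂ)) := by
    funext j
    simp only [Function.comp_apply, if_pos (dvd_mul_left m j), Int.mul_ediv_cancel j hm]
  rw [hfun] at h
  exact h

/-- `B_m(v,y)` as the sum of its Bessel row (`tsum` form of `hasSum_besselRow_μI`).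
[cite: DLMF, 10.35.2; DLMF, 10.12.2] -/
theorem integral_cexp_cos_add_cos_int_mul_μI_eq_tsum (v y : ℝ) {m : ℤ} (hm : m ≠ 0) :
    ∫ t, Complex.exp (((v * Real.cos t : ℝ) : ℂ) + ((y * Real.cos (m * t) : ℝ) : ℂ) * Complex.I) ∂μI
      = ∑' j : ℤ, (besselI (j * m) v : ℂ) * (2 * π * Complex.I ^ j.natAbs * (besselJ j.natAbs y : ℂ)) :=
  (hasSum_besselRow_μI v y hm).tsum_eq.symm

/-- The Bessel row converges ABSOLUTELY: `Σ_j |I_{jm}(v)| · 2π |J_{|j|}(y)| ≤ 2π Σ_a |I_a(v)| = 2π e^{|v|}`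
(`|J_n| ≤ 1`). [cite: DLMF, 10.35.2; DLMF, 10.14.1] -/
theorem summable_norm_besselRow (v y : ℝ) {m : ℤ} (hm : m ≠ 0) :
    Summable fun j : ℤ => ‖(besselI (j * m) v : ℂ)
        * (2 * π * Complex.I ^ j.natAbs * (besselJ j.natAbs y : ℂ))‖ := by
  have hinj : Function.Injective (fun j : ℤ => j * m) := mul_left_injective₀ hm
  have h1 : Summable fun j : ℤ => |besselI (j * m) v| * (2 * π) :=
    ((summable_abs_besselI v).comp_injective hinj).mul_right _
  refine h1.of_nonneg_of_le (fun j => norm_nonneg _) (fun j => ?_)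
  have hJ : |besselJ j.natAbs y| ≤ 1 := Literature.Analysis.FunctionSpaces.abs_besselJ_le_one_holds _ _
  rw [norm_mul, Complex.norm_real, Real.norm_eq_abs]
  refine mul_le_mul_of_nonneg_left ?_ (abs_nonneg _)
  rw [norm_mul, norm_mul, norm_pow, Complex.norm_I, one_pow, mul_one, Complex.norm_real,
    Real.norm_eq_abs, norm_mul, Complex.norm_real, Real.norm_eq_abs, abs_of_pos Real.pi_pos,
    Complex.norm_ofNat]
  nlinarith [hJ, Real.pi_pos, abs_nonneg (besselJ j.natAbs y)]

/-- **Folded (one-sided) form of the Bessel row**: since `I_{-a} = I_a`,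
`B_m(v,y) = Σ_{j ≥ 0} ε_j I_{jm}(v) · 2π iʲ J_j(y)` with `ε_0 = 1`, `ε_j = 2` (`j ≥ 1`), i.e.
`B_m(v,y) = 2π (I_0(v) J_0(y) + 2 Σ_{j ≥ 1} iʲ J_j(y) I_{jm}(v))` — the row a kernel tabulates.
[cite: DLMF, 10.35.2; DLMF, 10.12.3] -/
theorem hasSum_besselRow_nat_μI (v y : ℝ) {m : ℤ} (hm : m ≠ 0) :
    HasSum (fun j : ℕ => (if j = 0 then (1 : ℂ) else 2)
        * ((besselI (j * m) v : ℂ) * (2 * π * Complex.I ^ j * (besselJ j y : ℂ))))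
      (∫ t, Complex.exp (((v * Real.cos t : ℝ) : ℂ) + ((y * Real.cos (m * t) : ℝ) : ℂ) * Complex.I) ∂μI) := by
  set B := ∫ t, Complex.exp (((v * Real.cos t : ℝ) : ℂ) + ((y * Real.cos (m * t) : ℝ) : ℂ) * Complex.I) ∂μI
    with hB
  set f : ℤ → ℂ := fun j => (besselI (j * m) v : ℂ)
    * (2 * π * Complex.I ^ j.natAbs * (besselJ j.natAbs y : ℂ)) with hf
  have h := (hasSum_besselRow_μI v y hm).nat_add_neg
  -- `f (-n) = f n`
  have hsymm : ∀ n : ℕ, f (-(n : ℤ)) = f n := by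
    intro n
    simp only [hf, Int.natAbs_neg, Int.natAbs_natCast, neg_mul,
      Literature.Probability.LatticeModels.besselI_neg_index]
  have h2 : HasSum (fun n : ℕ => (2 : ℂ) * f n) (B + f 0) := by
    refine h.congr_fun fun n => ?_
    change 2 * f n = f n + f (-(n : ℤ))
    rw [hsymm, two_mul]
  have h0 : HasSum (fun n : ℕ => if n = 0 then f 0 else 0) (f 0) := hasSum_ite_eq 0 (f 0)
  have h3 := h2.sub h0
  rw [add_sub_cancel_right] at h3
  refine h3.congr_fun fun n => ?_
  change (if n = 0 then (1 : ℂ) else 2) * ((besselI (n * m) v : ℂ) * (2 * π * Complex.I ^ n * (besselJ n y : ℂ)))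
    = 2 * f n - (if n = 0 then f 0 else 0)
  rcases Nat.eq_zero_or_pos n with hn0 | hn0
  · subst hn0
    simp only [if_true, hf, Nat.cast_zero, zero_mul, Int.natAbs_zero, pow_zero]
    ring
  · simp only [if_neg hn0.ne', hf, Int.natAbs_natCast, sub_zero]

end Row

/-! ### 4. Glue: the twisted seeds of the trigonometric majorant at an axis node -/
section Glue

variable {d : ℕ}

/-- **`srwTwist` (weight `1`) at an axis node in Schwinger / axis-transform form**: for `d ≥ 2n + 3`,
every axis `i` and every `m : ℤ`,
`srwTwist d (n+1) 1 (m e_i) β = (n!)⁻¹ (∫₀^∞ τⁿ e^{-τ} Re B_m(τ/d, β/d)^d dτ) / (2π)^d`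
(the twist `β D̂^{(m e_i)}(k) = (β/d) Σ_j cos(m k_j)` is a sum over coordinates, so the cube integral
factorises after the Schwinger step; `integral_mul_Chat_pow_succ_eq_integral_Ioi_of_bdd`,
`integral_exp_mul_Dhat_mul_cos_P`).
[cite: FitznerVanDerHofstad2016NoBLE, (3.34)–(3.36) p. 1071; FitznerVanDerHofstad2016NoBLE, §5.1.1 (5.2)–(5.4)] -/
theorem srwTwist_succ_one_single_eq_integral_axisTransform (n : ℕ) (hd : 2 * (n + 1) + 1 ≤ d)
    (i : Fin d) (m : ℤ) (β : ℝ) :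
    srwTwist d (n + 1) (fun _ => 1) (Pi.single i m) β
      = (n ! : ℝ)⁻¹ * (∫ τ in Ioi (0:ℝ), τ ^ n * (Real.exp (-τ) *
          ((∫ t, Complex.exp (((τ / d * Real.cos t : ℝ) : ℂ)
              + ((β / d * Real.cos (m * t) : ℝ) : ℂ) * Complex.I) ∂μI) ^ d).re))
        / (2 * π) ^ d := by
  have hd0 : (d : ℝ) ≠ 0 := by
    have : 0 < d := by omega
    positivity
  have hph : ∀ k : Fin d → ℝ, β * DhatSym d (Pi.single i m) k = β / d * ∑ j, Real.cos (m * k j) := by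
    intro k
    rw [← natCast_mul_DhatSym_single_intCast i m k]
    field_simp
  have hWm : Measurable fun k : Fin d → ℝ => (1:ℝ) * Real.cos (β * DhatSym d (Pi.single i m) k) := by
    have := continuous_DhatSym d (Pi.single i m)
    exact Continuous.measurable (by fun_prop)
  have hW1 : ∀ k : Fin d → ℝ, |(1:ℝ) * Real.cos (β * DhatSym d (Pi.single i m) k)| ≤ 1 := fun k => by
    rw [one_mul]; exact Real.abs_cos_le_one _
  unfold srwTwist
  rw [integral_mul_Chat_pow_succ_eq_integral_Ioi_of_bdd n hd hWm hW1]
  congr 1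
  congr 1
  refine setIntegral_congr_fun measurableSet_Ioi fun τ _ => ?_
  congr 1
  have hexp : ∀ k : Fin d → ℝ, Real.exp (-((1 - Dhat d k) * τ)) = Real.exp (-τ) * Real.exp (τ * Dhat d k) := by
    intro k; rw [← Real.exp_add]; congr 1; ring
  simp_rw [one_mul, hph, hexp]
  calc ∫ k, Real.cos (β / d * ∑ j, Real.cos (m * k j)) * (Real.exp (-τ) * Real.exp (τ * Dhat d k)) ∂P d
      = Real.exp (-τ) * ∫ k, Real.exp (τ * Dhat d k) * Real.cos (β / d * ∑ j, Real.cos (m * k j)) ∂P d := by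
        rw [← integral_const_mul]
        congr 1
        funext k
        ring
    _ = Real.exp (-τ) * ((∫ t, Complex.exp (((τ / d * Real.cos t : ℝ) : ℂ)
              + ((β / d * Real.cos (m * t) : ℝ) : ℂ) * Complex.I) ∂μI) ^ d).re := by
        rw [integral_exp_mul_Dhat_mul_cos_P]

/-- The same with the one-coordinate transform replaced by its Bessel row (`m ≠ 0`):
`srwTwist d (n+1) 1 (m e_i) β
   = (n!)⁻¹ (∫₀^∞ τⁿ e^{-τ} Re (Σ_{j∈ℤ} I_{jm}(τ/d) · 2π i^{|j|} J_{|j|}(β/d))^d dτ) / (2π)^d` —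
the EXACT identity behind the kernel rows `(Σ_a c(a) I_a(v))^d` of a twisted seed certificate.
[cite: FitznerVanDerHofstad2016NoBLE, (3.34)–(3.36) p. 1071; DLMF, 10.35.2; DLMF, 10.12.2] -/
theorem srwTwist_succ_one_single_eq_integral_besselRow (n : ℕ) (hd : 2 * (n + 1) + 1 ≤ d)
    (i : Fin d) {m : ℤ} (hm : m ≠ 0) (β : ℝ) :
    srwTwist d (n + 1) (fun _ => 1) (Pi.single i m) β
      = (n ! : ℝ)⁻¹ * (∫ τ in Ioi (0:ℝ), τ ^ n * (Real.exp (-τ) *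
          ((∑' j : ℤ, (besselI (j * m) (τ / d) : ℂ)
              * (2 * π * Complex.I ^ j.natAbs * (besselJ j.natAbs (β / d) : ℂ))) ^ d).re))
        / (2 * π) ^ d := by
  rw [srwTwist_succ_one_single_eq_integral_axisTransform n hd i m β]
  congr 1
  congr 1
  refine setIntegral_congr_fun measurableSet_Ioi fun τ _ => ?_
  rw [integral_cexp_cos_add_cos_int_mul_μI_eq_tsum (τ / d) (β / d) hm]

end Glue

end Literature.Probability.FitznerVanDerHofstad2017

end
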